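import Literature.Barriers.CriticalPhenomena.PlaquetteWalkHoleRootHoleColumnSevenTurns
import Literature.Barriers.CriticalPhenomena.PlaquetteWalkHoleRootHoleColumnDescent
import Literature.Barriers.CriticalPhenomena.PlaquetteWalkHoleRootTailRootRow
import Literature.Barriers.CriticalPhenomena.PlaquetteWalkHoleRootRayArc
import HarnessLib

/-!
# Barrier catalogue (SAWScalingLimit): in the HOLE COLUMN the west turn of the straight level-`7` member goes DOWN, to a bottom-row turn («HOLE COLUMN: THE WEST LEG»)

`Z → ∞` limit model of the printed Yang–Baxter weights [GlazmanManolescu2019, §1, eq. (1)]; the «RECTANGLE COEFFICIENT» line (b-engine-1 g29), the frame of the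
HOLE-COLUMN programme (FINDING-YB-HOLE-COLUMN-FOUR-PHASE; DESIGN-next b-engine-1 g28 §6 (a1), (a3)). In the setting of the export lemma
`ΩG.sevenTurns_of_cost_seven_straight_holeColumn_above` (#1443) — a wound class-`B2a` walk of limit cost `7` from the hole root `w.side W`, slanted end, straight first
arc at a hole-column rhombus `r = (w.1 − 1, r.2)` strictly above the hole, some arc above the row of `r`; seven isolated turns `t₁, t₂` (top row `Y`), `b₁, b₂` (bottom
row `Y'`), `τ = (τ1, w.2)`, `e_W = (r.1 − MW, r.2)`, `e_E = (r.1 + ME, r.2)` — and of `ΩG.descent_of_cost_seven_straight_holeColumn_above` (#1406: end `N`, a straight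
final descent of the hole column from `T = (r.1, Y)`):

* ★★★ `ΩG.westLeg_of_cost_seven_straight_holeColumn_above`: `T = (r.1, Y)` IS one of the two top turns, and THE WEST TURN `e_W` TURNS DOWN: it uses `S`, not `N`, its
  `S`-chain is the whole column `x = r.1 − MW` from the row of `r` through the root row WEST OF THE HOLE down to the bottom row, and `b_W = (r.1 − MW, Y')` is one of the
  two bottom turns (it uses `N`, not `S`). The statement re-exports the seven turns with `t₁ = T` and `b₁ = b_W` made explicit, so that the later frame cars import it
  alone. WHY `e_W` cannot turn up: its `N`-chain would end at the western top turn `(r.1 − MW, Y)`, the top row would be the run from there to `T`, and reading the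
  walk backwards from the final descent — top row westwards, down the column `r.1 − MW`, east along the row of `r` — pins every excursion arc to a row `≥ r.2`; but the
  excursion of a WOUND walk to a western rhombus meets the eastern ray of the hole on the root row (`ΩG.exists_tail_arc_rootRow_S`, the even–odd rule).

[GlazmanManolescu2019 §1 Fig. 1, eq. (1), Lemma 2.1, Remark 2.2; Glazman2015WeightedSAW Lemma 3.1 (proof, pp. 6–7); CourantRobbins1958 Ch. V App. §2 (the even–odd rule)]
-/

noncomputable section

namespace Literature.Probability.RandomPlanarGeometry.SAW.YangBaxter

open Real
open Literature.Barriers.CriticalPhenomena.PlaquetteWalk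

open private fc_fh fh_add_Mv three_le_Mv from Literature.Probability.RandomPlanarGeometry.YangBaxterSAWGeneralDomain
open private fc_sOut_pred_of_sIn_S fc_sOut_pred_of_sIn_N from Literature.Barriers.CriticalPhenomena.PlaquetteWalkStraightRuns

namespace ΩG

variable {D : Set Face} {w r : Face} {ω : ΩG D (w.side .W) r}

/-- ★★★ **HOLE COLUMN: THE WEST LEG.** Let `ω` be a wound class-`B2a` walk of limit cost `7` from the hole root `w.side W` (hole `(w.1 − 1, w.2)` absent) with a slanted end
and a STRAIGHT first arc at a rhombus `r` of the hole column (`r.1 = w.1 − 1`) strictly above the hole, some arc of `ω` lying strictly above the row of `r`. Then, with the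
top row `Y`, the bottom row `Y'`, the root-row turn `(τ1, w.2)` and the chain ends `e_W = (r.1 − MW, r.2)`, `e_E = (r.1 + ME, r.2)` of the export lemma: the seven isolated
turns are `T = (r.1, Y)` (the top of the final descent), a second top-row turn `t₂`, `b_W = (r.1 − MW, Y')`, a second bottom-row turn `b₂`, `τ`, `e_W`, `e_E`; the end is
`N`, the last plaquette `(r.1, r.2 + 1)` is left through `S` and the final `Y − r.2` arcs descend the hole column from `T`; and the west turn `e_W` uses `S` and not `N`,
the plaquettes `(r.1 − MW, r.2 − m)`, `1 ≤ m ≤ r.2 − Y'`, use `N`, those with `m < r.2 − Y'` use `S`, and `b_W` does not use `S` (the WEST LEG of the loop, down through the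
root row west of the hole). [cite: GlazmanManolescu2019, §1, Fig. 1 and eq. (1); Lemma 2.1; Remark 2.2] [cite: Glazman2015WeightedSAW, Lemma 3.1 (proof, pp. 6–7)]
[cite: CourantRobbins1958, Ch. V Appendix §2 (the even–odd rule)] -/
theorem westLeg_of_cost_seven_straight_holeColumn_above (hh : holeFaceW w ∉ D) (hr : RootedFace D (w.side .W) r) (h : ω.IsB2a)
    (hA : ω.AJ hr h (toC (midPt (w.side .W))) ≠ 0) (hc : cost (slotOfSide ω.1) ω.2.mids = 7) (hz : ω.1 = .N ∨ ω.1 = .S)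
    (hstr8 : arcKind (ω.2.sIn ω.2.firstHitG) (ω.2.sOut ω.2.firstHitG) = .straight) (hcol : r.1 = w.1 - 1) (habove : w.2 < r.2)
    (hup : ∃ j < ω.2.arcs.length, r.2 < (ω.2.fc j).2) :
    ∃ (Y Y' τ1 : ℤ) (MW ME : ℕ) (t₂ b₂ : Face),
      (∀ j < ω.2.arcs.length, (ω.2.fc j).2 ≤ Y) ∧ (∀ j < ω.2.arcs.length, Y' ≤ (ω.2.fc j).2) ∧ r.2 < Y ∧ Y' < w.2 ∧
      t₂.2 = Y ∧ t₂.1 ≠ r.1 ∧ b₂.2 = Y' ∧ b₂.1 ≠ r.1 - MW ∧ w.1 ≤ τ1 ∧ 1 ≤ MW ∧ 1 ≤ ME ∧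
      (∀ m : ℕ, 1 ≤ m → m ≤ MW → ω.2.UsesSide (r.1 - m, r.2) .E) ∧ (∀ m : ℕ, m < MW → ω.2.UsesSide (r.1 - m, r.2) .W) ∧
        ¬ω.2.UsesSide (r.1 - MW, r.2) .W ∧
      (∀ m : ℕ, 1 ≤ m → m ≤ ME → ω.2.UsesSide (r.1 + m, r.2) .W) ∧ (∀ m : ℕ, m < ME → ω.2.UsesSide (r.1 + m, r.2) .E) ∧
        ¬ω.2.UsesSide (r.1 + ME, r.2) .E ∧
      (∀ f ∈ ({((r.1 : ℤ), Y), t₂, ((r.1 : ℤ) - MW, Y'), b₂, ((τ1 : ℤ), w.2), ((r.1 : ℤ) - MW, r.2), ((r.1 : ℤ) + ME, r.2)} : Finset Face),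
        f ∈ facesL ω.2.mids ∧ (kindsL ω.2.mids f = [.corner] ∨ kindsL ω.2.mids f = [.coCorner])) ∧
      (∀ f : Face, f ∈ facesL ω.2.mids → (kindsL ω.2.mids f = [.corner] ∨ kindsL ω.2.mids f = [.coCorner]) →
        f ∈ ({((r.1 : ℤ), Y), t₂, ((r.1 : ℤ) - MW, Y'), b₂, ((τ1 : ℤ), w.2), ((r.1 : ℤ) - MW, r.2), ((r.1 : ℤ) + ME, r.2)} : Finset Face)) ∧
      ω.1 = .N ∧ ω.2.fc (ω.2.arcs.length - 1) = (r.1, r.2 + 1) ∧ ω.2.sOut (ω.2.arcs.length - 1) = .S ∧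
      (∀ m : ℕ, (m : ℤ) ≤ Y - r.2 - 1 → ω.2.fc (ω.2.arcs.length - 1 - m) = (r.1, r.2 + 1 + m)) ∧
      (∀ m : ℕ, (m : ℤ) < Y - r.2 - 1 → ω.2.sIn (ω.2.arcs.length - 1 - m) = .N) ∧
      ω.2.UsesSide (r.1 - MW, r.2) .S ∧ ¬ω.2.UsesSide (r.1 - MW, r.2) .N ∧
      (∀ m : ℕ, 1 ≤ m → (m : ℤ) ≤ r.2 - Y' → ω.2.UsesSide (r.1 - MW, r.2 - m) .N) ∧
      (∀ m : ℕ, (m : ℤ) < r.2 - Y' → ω.2.UsesSide (r.1 - MW, r.2 - m) .S) ∧ ¬ω.2.UsesSide (r.1 - MW, Y') .S := by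
  classical
  set n := ω.2.arcs.length with hn
  ---------------------------------------------------------------- basics
  have hF := ω.fh_lt h
  have hlen : 0 < n := by omega
  have h0w : ω.2.fc 0 = w := fc_zero_eq_root w hh ω.2 hlen
  have h0W : ω.2.sIn 0 = .W := YBWalk.sIn_zero_eq_W hh ω.2 hlen
  have h0E : ω.2.sIn 0 ≠ .E := by rw [h0W]; decide
  have h0N : ω.2.sIn 0 ≠ .N := by rw [h0W]; decide
  have h0S : ω.2.sIn 0 ≠ .S := by rw [h0W]; decide
  have hfcF := (fc_fh ω hr h).1
  have hsvr : ∀ l < n, ω.2.fc l = ω.2.fc ω.2.firstHitG → l = ω.2.firstHitG := fun l hl e => eq_firstHitG_of_fc_eq hr h hl e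
  have hn1 : n - 1 < n := by omega
  have hwr : r.1 < w.1 := by omega
  ---------------------------------------------------------------- the seven turns (export lemma) and the descent
  obtain ⟨Y, Y', τ1, MW, ME, t₁, t₂, b₁, b₂, hY, hY', hr₃, hY'w, ht₁row, ht₂row, ht12, hb₁row, hb₂row, hb12, hτ1w, hMW1, hME1,
    hEW, hWW, hnotW, hWE, hEE, hnotE, hseven, hall⟩ :=
    sevenTurns_of_cost_seven_straight_holeColumn_above hh hr h hA hc hz hstr8 hcol habove hup
  obtain ⟨hN1, hL, hLS, Y₀, hY₀, hrY₀, hdesc, hdescIn⟩ := descent_of_cost_seven_straight_holeColumn_above hh hr h hA hc hz hstr8 hcol habove hup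
  let P : Face → Prop := fun f => f ∈ facesL ω.2.mids ∧ (kindsL ω.2.mids f = [.corner] ∨ kindsL ω.2.mids f = [.coCorner])
  have hPiso : ∀ k < n, (∀ l < n, ω.2.fc l = ω.2.fc k → l = k) → arcKind (ω.2.sIn k) (ω.2.sOut k) ≠ .straight → P (ω.2.fc k) :=
    fun k hk hsv hkind => isolated_turn hk hsv hkind
  have hmem7 : ∀ f : Face, P f → f = t₁ ∨ f = t₂ ∨ f = b₁ ∨ f = b₂ ∨ f = ((τ1 : ℤ), w.2) ∨ f = ((r.1 : ℤ) - MW, r.2) ∨ f = ((r.1 : ℤ) + ME, r.2) := by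
    intro f hPf
    have := hall f hPf.1 hPf.2
    simpa only [Finset.mem_insert, Finset.mem_singleton] using this
  have hP7 : ∀ f : Face, (f = t₁ ∨ f = t₂ ∨ f = b₁ ∨ f = b₂ ∨ f = ((τ1 : ℤ), w.2) ∨ f = ((r.1 : ℤ) - MW, r.2) ∨ f = ((r.1 : ℤ) + ME, r.2)) → P f := by
    intro f hf
    apply hseven
    simpa only [Finset.mem_insert, Finset.mem_singleton] using hf
  have hProw : ∀ f : Face, P f → f.2 = Y ∨ f.2 = Y' ∨ f.2 = w.2 ∨ f.2 = r.2 := by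
    intro f hPf
    rcases hmem7 f hPf with rfl | rfl | rfl | rfl | rfl | rfl | rfl
    · exact Or.inl ht₁row
    · exact Or.inl ht₂row
    · exact Or.inr (Or.inl hb₁row)
    · exact Or.inr (Or.inl hb₂row)
    · exact Or.inr (Or.inr (Or.inl rfl))
    · exact Or.inr (Or.inr (Or.inr rfl))
    · exact Or.inr (Or.inr (Or.inr rfl))
  -- the two `Y`'s agree
  have hYY : Y = Y₀ := by
    apply le_antisymm
    · obtain ⟨j, hj, hfj⟩ := ω.2.exists_fc_eq_of_mem_facesL (hP7 t₁ (Or.inl rfl)).1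
      have := hY₀ j hj; rw [hfj, ht₁row] at this; exact this
    · have e2 : ∀ m : ℕ, (m : ℤ) ≤ Y₀ - r.2 - 1 → (r.2 + 1 + m : ℤ) ≤ Y := by
        intro m hm; have := hY (n - 1 - m) (by omega); rw [hdesc m hm] at this; exact this
      obtain ⟨d, hd⟩ : ∃ d : ℕ, (d : ℤ) = Y₀ - r.2 - 1 := ⟨(Y₀ - r.2 - 1).toNat, by omega⟩
      have := e2 d (by omega); omega
  subst hYY
  obtain ⟨X', -, hX', -⟩ := exists_right_entry_turn hh hr h
  obtain ⟨X, hXw, hX, -⟩ := exists_left_entry_turn hh hr h hA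
  ---------------------------------------------------------------- rows: a plaquette using `E` or `W` lies on one of the four turn rows
  have hrowE : ∀ c : Face, ω.2.UsesSide c .E → c.2 = Y ∨ c.2 = Y' ∨ c.2 = w.2 ∨ c.2 = r.2 := by
    intro c hcE
    obtain ⟨M, hWall, -, hend⟩ := ω.2.chain_E hX' hcE
    rcases hend with ⟨hM1, hnot⟩ | ⟨-, hs0⟩ | ⟨-, hsZ⟩
    · obtain ⟨i', hi', hfc', hsv', -, -, -, hk'⟩ := ω.2.isolated_of_usesSide_not_opp (hWall M hM1 le_rfl) hnot
      have hP' : P (c.1 + M, c.2) := by rw [← hfc']; exact hPiso i' hi' hsv' hk'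
      have := hProw _ hP'; simp only at this; exact this
    · exact absurd hs0 h0E
    · rw [hLS] at hsZ; exact absurd hsZ (by decide)
  have hrowW : ∀ c : Face, ω.2.UsesSide c .W → c.2 = Y ∨ c.2 = Y' ∨ c.2 = w.2 ∨ c.2 = r.2 := by
    intro c hcW
    obtain ⟨M, hEall, -, hend⟩ := ω.2.chain_W hX hcW
    rcases hend with ⟨hM1, hnot⟩ | ⟨hA0, -⟩ | ⟨-, hsZ⟩
    · obtain ⟨i', hi', hfc', hsv', -, -, -, hk'⟩ := ω.2.isolated_of_usesSide_not_opp (hEall M hM1 le_rfl) hnot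
      have hP' : P (c.1 - M, c.2) := by rw [← hfc']; exact hPiso i' hi' hsv' hk'
      have := hProw _ hP'; simp only at this; exact this
    · rw [h0w] at hA0; have := congrArg Prod.snd hA0; simp only at this; exact Or.inr (Or.inr (Or.inl this))
    · rw [hLS] at hsZ; exact absurd hsZ (by decide)
  -- hence a plaquette off these rows carries only vertical (straight) arcs
  have hvert : ∀ i < n, (ω.2.fc i).2 ≠ Y → (ω.2.fc i).2 ≠ Y' → (ω.2.fc i).2 ≠ w.2 → (ω.2.fc i).2 ≠ r.2 →
      arcKind (ω.2.sIn i) (ω.2.sOut i) = .straight := by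
    intro i hi h1 h2 h3 h4
    have hnot : ¬(ω.2.UsesSide (ω.2.fc i) .E ∨ ω.2.UsesSide (ω.2.fc i) .W) := by
      rintro (hu | hu)
      · rcases hrowE _ hu with e | e | e | e
        · exact h1 e
        · exact h2 e
        · exact h3 e
        · exact h4 e
      · rcases hrowW _ hu with e | e | e | e
        · exact h1 e
        · exact h2 e
        · exact h3 e
        · exact h4 e
    have hiE : ω.2.sIn i ≠ .E := fun e => hnot (Or.inl ⟨i, hi, rfl, Or.inl e⟩)
    have hoE : ω.2.sOut i ≠ .E := fun e => hnot (Or.inl ⟨i, hi, rfl, Or.inr e⟩)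
    have hiW : ω.2.sIn i ≠ .W := fun e => hnot (Or.inr ⟨i, hi, rfl, Or.inl e⟩)
    have hoW : ω.2.sOut i ≠ .W := fun e => hnot (Or.inr ⟨i, hi, rfl, Or.inr e⟩)
    have hne := ω.2.sIn_ne_sOut hi
    revert hiE hoE hiW hoW hne
    cases ω.2.sIn i <;> cases ω.2.sOut i <;> decide
  ---------------------------------------------------------------- the top of the descent `T = (r.1, Y)` is one of the two top turns
  have hNtop := forall_top_ne_N hh hr h hY (by omega)
  obtain ⟨dT, hdT⟩ : ∃ dT : ℕ, (dT : ℤ) = Y - r.2 - 1 := ⟨(Y - r.2 - 1).toNat, by omega⟩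
  have hjTn : n - 1 - dT < n := by omega
  have hfcT : ω.2.fc (n - 1 - dT) = (r.1, Y) := by rw [hdesc dT (by omega)]; exact Prod.ext rfl (by simp only; omega)
  have hjT1 : 1 ≤ n - 1 - dT := by
    by_contra hlt
    have e0 : n - 1 - dT = 0 := by omega
    have e := hfcT
    rw [e0, h0w] at e
    have := congrArg Prod.fst e; simp only at this; omega
  have hTS : ω.2.sOut (n - 1 - dT) = .S := by
    rcases Nat.eq_zero_or_pos dT with h0 | hpos
    · rw [h0, Nat.sub_zero]; exact hLS
    · have hlt : ((dT - 1 : ℕ) : ℤ) < Y - r.2 - 1 := by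
        rw [Nat.cast_sub (by omega : 1 ≤ dT)]; push_cast; omega
      have hin := hdescIn (dT - 1) hlt
      have := (fc_sOut_pred_of_sIn_N ω.2 (i := n - 1 - (dT - 1)) (by omega) (by omega) hin).2
      rwa [show n - 1 - (dT - 1) - 1 = n - 1 - dT by omega] at this
  have hTnN : ¬ω.2.UsesSide ((r.1 : ℤ), Y) .N := by
    rintro ⟨j, hj, hfj, hs⟩
    have := hNtop j hj (by rw [hfj])
    rcases hs with hs | hs
    · exact this.1 hs
    · exact this.2 hs
  have hsvT : ∀ l < n, ω.2.fc l = ω.2.fc (n - 1 - dT) → l = n - 1 - dT :=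
    fun l hl e => ω.2.single_visit_of_not_usesSide hTnN hl hjTn (e.trans hfcT) hfcT
  have hTk : arcKind (ω.2.sIn (n - 1 - dT)) (ω.2.sOut (n - 1 - dT)) ≠ .straight := by
    have h1 := (hNtop _ hjTn (by rw [hfcT])).1
    rw [hTS]; revert h1; cases ω.2.sIn (n - 1 - dT) <;> decide
  have hPT : P ((r.1 : ℤ), Y) := by rw [← hfcT]; exact hPiso _ hjTn hsvT hTk
  -- name the other top turn `tₒ`
  obtain ⟨tₒ, hPtₒ, htₒrow, htₒne, htop2⟩ : ∃ tₒ : Face, P tₒ ∧ tₒ.2 = Y ∧ tₒ ≠ ((r.1 : ℤ), Y) ∧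
      ∀ f : Face, P f → f.2 = Y → f = ((r.1 : ℤ), Y) ∨ f = tₒ := by
    have htops : ∀ f : Face, P f → f.2 = Y → f = t₁ ∨ f = t₂ := by
      intro f hPf hfY
      rcases hmem7 f hPf with e | e | e | e | e | e | e
      · exact Or.inl e
      · exact Or.inr e
      · exfalso; rw [e, hb₁row] at hfY; omega
      · exfalso; rw [e, hb₂row] at hfY; omega
      · exfalso; rw [e] at hfY; simp only at hfY; omega
      · exfalso; rw [e] at hfY; simp only at hfY; omega
      · exfalso; rw [e] at hfY; simp only at hfY; omega
    rcases htops _ hPT rfl with hT | hT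
    · refine ⟨t₂, hP7 t₂ (Or.inr (Or.inl rfl)), ht₂row, fun e => ht12 (hT.symm.trans e.symm), fun f hPf hfY => ?_⟩
      rcases htops f hPf hfY with e | e
      · exact Or.inl (e.trans hT.symm)
      · exact Or.inr e
    · refine ⟨t₁, hP7 t₁ (Or.inl rfl), ht₁row, fun e => ht12 (e.trans hT), fun f hPf hfY => ?_⟩
      rcases htops f hPf hfY with e | e
      · exact Or.inr e
      · exact Or.inl (e.trans hT.symm)
  have htₒcol : tₒ.1 ≠ r.1 := by
    intro e; apply htₒne; exact Prod.ext e htₒrow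
  -- the bottom turns
  have hbots : ∀ f : Face, P f → f.2 = Y' → f = b₁ ∨ f = b₂ := by
    intro f hPf hfY
    rcases hmem7 f hPf with e | e | e | e | e | e | e
    · exfalso; rw [e, ht₁row] at hfY; omega
    · exfalso; rw [e, ht₂row] at hfY; omega
    · exact Or.inl e
    · exact Or.inr e
    · exfalso; rw [e] at hfY; simp only at hfY; omega
    · exfalso; rw [e] at hfY; simp only at hfY; omega
    · exfalso; rw [e] at hfY; simp only at hfY; omega
  ---------------------------------------------------------------- THE WEST TURN USES `S`
  have heWE : ω.2.UsesSide ((r.1 : ℤ) - MW, r.2) .E := hEW MW hMW1 le_rfl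
  have hsvW : ∀ i j, i < n → j < n → ω.2.fc i = ((r.1 : ℤ) - MW, r.2) → ω.2.fc j = ((r.1 : ℤ) - MW, r.2) → i = j :=
    fun i j hi hj hci hcj => ω.2.single_visit_of_not_usesSide hnotW hi hj hci hcj
  obtain ⟨jW, hjW, hfcW, hsE⟩ := heWE
  have heWS : ω.2.UsesSide ((r.1 : ℤ) - MW, r.2) .S := by
    by_contra hnS
    -- then `e_W` turns `N`, and its `N`-chain ends at the western top turn `(r.1 − MW, Y) = tₒ`
    have heWN : ω.2.UsesSide ((r.1 : ℤ) - MW, r.2) .N := by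
      refine ⟨jW, hjW, hfcW, ?_⟩
      have hne := ω.2.sIn_ne_sOut hjW
      have hnW1 : ω.2.sIn jW ≠ .W := fun e => hnotW ⟨jW, hjW, hfcW, Or.inl e⟩
      have hnW2 : ω.2.sOut jW ≠ .W := fun e => hnotW ⟨jW, hjW, hfcW, Or.inr e⟩
      have hnS1 : ω.2.sIn jW ≠ .S := fun e => hnS ⟨jW, hjW, hfcW, Or.inl e⟩
      have hnS2 : ω.2.sOut jW ≠ .S := fun e => hnS ⟨jW, hjW, hfcW, Or.inr e⟩
      revert hsE hne hnW1 hnW2 hnS1 hnS2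
      cases ω.2.sIn jW <;> cases ω.2.sOut jW <;> decide
    obtain ⟨M, hSall, hNall, hend⟩ := ω.2.chain_N hY heWN
    simp only at hSall hNall hend
    have htₒeq : tₒ = ((r.1 : ℤ) - MW, Y) ∧ (M : ℤ) = Y - r.2 := by
      rcases hend with ⟨hM1, hnot⟩ | ⟨-, hs0⟩ | ⟨hZ, hsZ⟩
      · obtain ⟨i', hi', hfc', hsv', -, -, -, hk'⟩ := ω.2.isolated_of_usesSide_not_opp (hSall M hM1 le_rfl) hnot
        have hP' : P ((r.1 : ℤ) - MW, r.2 + M) := by rw [← hfc']; exact hPiso i' hi' hsv' hk'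
        have hrow' : ((((r.1 : ℤ) - MW, r.2 + M) : Face)).2 = Y := by
          rcases hProw _ hP' with e | e | e | e <;> simp only at e ⊢ <;> omega
        rcases htop2 _ hP' hrow' with e | e
        · have := congrArg Prod.fst e; simp only at this; omega
        · simp only at hrow'
          refine ⟨?_, by omega⟩
          rw [← e]; exact Prod.ext rfl (by simp only; omega)
      · exact absurd hs0 h0N
      · rw [hLS] at hsZ; exact absurd hsZ (by decide)
    obtain ⟨htₒ, hM⟩ := htₒeq
    -- `T` is entered from `W`, and the top row runs from `tₒ` to `T`
    have hTin : ω.2.sIn (n - 1 - dT) = .W := by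
      have h1 := (hNtop _ hjTn (by rw [hfcT])).1
      have hne := ω.2.sIn_ne_sOut hjTn
      rw [hTS] at hne
      have hnE : ω.2.sIn (n - 1 - dT) ≠ .E := by
        intro hE
        obtain ⟨M', hWall, -, hend'⟩ := ω.2.chain_E hX' ⟨_, hjTn, hfcT, Or.inl hE⟩
        simp only at hWall hend'
        rcases hend' with ⟨hM1, hnot⟩ | ⟨-, hs0⟩ | ⟨-, hsZ⟩
        · obtain ⟨i', hi', hfc', hsv', -, -, -, hk'⟩ := ω.2.isolated_of_usesSide_not_opp (hWall M' hM1 le_rfl) hnot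
          have hP' : P ((r.1 : ℤ) + M', Y) := by rw [← hfc']; exact hPiso i' hi' hsv' hk'
          rcases htop2 _ hP' rfl with e | e
          · have := congrArg Prod.fst e; simp only at this; omega
          · rw [htₒ] at e; have := congrArg Prod.fst e; simp only at this; omega
        · exact absurd hs0 h0E
        · rw [hLS] at hsZ; exact absurd hsZ (by decide)
      revert h1 hne hnE; cases ω.2.sIn (n - 1 - dT) <;> decide
    obtain ⟨M₂, hE2, hW2, hend2⟩ := ω.2.chain_W hX ⟨_, hjTn, hfcT, Or.inl hTin⟩
    simp only at hE2 hW2 hend2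
    obtain ⟨hM₂, htₒnW⟩ : M₂ = MW ∧ ¬ω.2.UsesSide ((r.1 : ℤ) - MW, Y) .W := by
      rcases hend2 with ⟨hM1, hnot⟩ | ⟨hA0, -⟩ | ⟨-, hsZ⟩
      · obtain ⟨i', hi', hfc', hsv', -, -, -, hk'⟩ := ω.2.isolated_of_usesSide_not_opp (hE2 M₂ hM1 le_rfl) hnot
        have hP' : P ((r.1 : ℤ) - M₂, Y) := by rw [← hfc']; exact hPiso i' hi' hsv' hk'
        rcases htop2 _ hP' rfl with e | e
        · have := congrArg Prod.fst e; simp only at this; omega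
        · rw [htₒ] at e; have := congrArg Prod.fst e; simp only at this
          have eM : M₂ = MW := by omega
          subst eM; exact ⟨rfl, hnot⟩
      · rw [h0w] at hA0; have := congrArg Prod.snd hA0; simp only at this; omega
      · rw [hLS] at hsZ; exact absurd hsZ (by decide)
    subst hM₂
    have htopStraight : ∀ m : ℕ, 1 ≤ m → m ≤ M₂ - 1 → ∀ i < n, ω.2.fc i = ((r.1 : ℤ) - m, Y) → arcKind (ω.2.sIn i) (ω.2.sOut i) = .straight := by
      intro m hm1 hmM i hi hfi
      have hnN : ¬ω.2.UsesSide ((r.1 : ℤ) - m, Y) .N := by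
        rintro ⟨j, hj, hfj, hs⟩
        have := hNtop j hj (by rw [hfj])
        rcases hs with hs | hs
        · exact this.1 hs
        · exact this.2 hs
      exact ω.2.straight_of_usesSide_EW (hE2 m hm1 (by omega)) (hW2 m (by omega)) hnN i hi hfi
    -- read the walk backwards: the top row westwards from `T` to `tₒ`
    have hMWT : M₂ - 1 ≤ n - 1 - dT := by
      by_contra hlt
      push Not at hlt
      obtain ⟨hfc0, -⟩ := ω.2.run_back_west_of_straight hjTn le_rfl hTin
        (fun m hm1 hmM i hi hfi => htopStraight m hm1 (by omega) i hi (by rw [hfi, hfcT])) (n - 1 - dT) le_rfl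
      rw [Nat.sub_self, h0w, hfcT] at hfc0
      have := congrArg Prod.snd hfc0; simp only at this; omega
    have hrunT := ω.2.run_back_west_of_straight hjTn hMWT hTin
      (fun m hm1 hmM i hi hfi => htopStraight m hm1 hmM i hi (by rw [hfi, hfcT]))
    obtain ⟨hfcT1, hinT1⟩ := hrunT (M₂ - 1) le_rfl
    rw [hfcT] at hfcT1; simp only at hfcT1
    have hjₒ1 : 1 ≤ n - 1 - dT - (M₂ - 1) := by
      by_contra hlt
      have e0 : n - 1 - dT - (M₂ - 1) = 0 := by omega
      rw [e0, h0w] at hfcT1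
      have := congrArg Prod.snd hfcT1; simp only at this; omega
    obtain ⟨hfcₒ, houtₒ⟩ := ω.2.fc_pred_eq_of_sIn_W (by omega) hjₒ1 hinT1
    rw [hfcT1] at hfcₒ
    rw [show n - 1 - dT - (M₂ - 1) - 1 = n - 1 - dT - M₂ by omega] at hfcₒ houtₒ
    simp only at hfcₒ
    have hfcₒ' : ω.2.fc (n - 1 - dT - M₂) = ((r.1 : ℤ) - M₂, Y) := by rw [hfcₒ]; exact Prod.ext (by simp only; omega) rfl
    have hjₒn : n - 1 - dT - M₂ < n := by omega
    -- `tₒ` is entered from `S`: down the column `r.1 − MW` to `e_W`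
    have hinₒ : ω.2.sIn (n - 1 - dT - M₂) = .S := by
      have h1 := (hNtop _ hjₒn (by rw [hfcₒ'])).1
      have hne := ω.2.sIn_ne_sOut hjₒn
      rw [houtₒ] at hne
      have hnW1 : ω.2.sIn (n - 1 - dT - M₂) ≠ .W := fun e => htₒnW ⟨_, hjₒn, hfcₒ', Or.inl e⟩
      revert h1 hne hnW1; cases ω.2.sIn (n - 1 - dT - M₂) <;> decide
    have hcolStraight : ∀ m : ℕ, 1 ≤ m → m ≤ dT → ∀ i < n, ω.2.fc i = ((r.1 : ℤ) - M₂, Y - m) → arcKind (ω.2.sIn i) (ω.2.sOut i) = .straight := by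
      intro m hm1 hmM i hi hfi
      exact hvert i hi (by rw [hfi]; simp only; omega) (by rw [hfi]; simp only; omega) (by rw [hfi]; simp only; omega)
        (by rw [hfi]; simp only; omega)
    have hdTₒ : dT ≤ n - 1 - dT - M₂ := by
      by_contra hlt
      push Not at hlt
      obtain ⟨hfc0, -⟩ := ω.2.run_back_below_of_straight hjₒn le_rfl hinₒ
        (fun m hm1 hmM i hi hfi => hcolStraight m hm1 (by omega) i hi (by rw [hfi, hfcₒ'])) (n - 1 - dT - M₂) le_rfl
      rw [Nat.sub_self, h0w, hfcₒ'] at hfc0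
      have := congrArg Prod.fst hfc0; simp only at this; omega
    have hrunₒ := ω.2.run_back_below_of_straight hjₒn hdTₒ hinₒ
      (fun m hm1 hmM i hi hfi => hcolStraight m hm1 hmM i hi (by rw [hfi, hfcₒ']))
    obtain ⟨hfcq, hinq⟩ := hrunₒ dT le_rfl
    rw [hfcₒ'] at hfcq; simp only at hfcq
    have hj₁1 : 1 ≤ n - 1 - dT - M₂ - dT := by
      by_contra hlt
      have e0 : n - 1 - dT - M₂ - dT = 0 := by omega
      rw [e0, h0w] at hfcq
      have := congrArg Prod.fst hfcq; simp only at this; omega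
    obtain ⟨hfc₁, hout₁⟩ := fc_sOut_pred_of_sIn_S ω.2 (i := n - 1 - dT - M₂ - dT) (by omega) hj₁1 hinq
    rw [hfcq] at hfc₁; simp only at hfc₁
    set j₁ := n - 1 - dT - M₂ - dT - 1 with hj₁def
    have hfc₁' : ω.2.fc j₁ = ((r.1 : ℤ) - M₂, r.2) := by rw [hfc₁]; exact Prod.ext rfl (by simp only; omega)
    have hj₁n : j₁ < n := by omega
    -- `e_W` is entered from `E`: east along the row of `r` back to `r`
    have hj₁W : j₁ = jW := hsvW _ _ hj₁n hjW hfc₁' hfcW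
    have hin₁ : ω.2.sIn j₁ = .E := by
      rw [hj₁W]; rw [hj₁W] at hout₁
      rcases hsE with e | e
      · exact e
      · rw [hout₁] at e; exact absurd e (by decide)
    have hrowStraight : ∀ m : ℕ, 1 ≤ m → m ≤ M₂ - 1 → ∀ i < n, ω.2.fc i = ((r.1 : ℤ) - M₂ + m, r.2) →
        arcKind (ω.2.sIn i) (ω.2.sOut i) = .straight := by
      intro m hm1 hmM i hi hfi
      have hcE : ω.2.UsesSide ((r.1 : ℤ) - M₂ + m, r.2) .E := by
        have := hEW (M₂ - m) (by omega) (by omega)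
        rwa [show (r.1 : ℤ) - ((M₂ - m : ℕ) : ℤ) = r.1 - M₂ + m by push_cast [Nat.cast_sub (show m ≤ M₂ by omega)]; ring] at this
      have hcW : ω.2.UsesSide ((r.1 : ℤ) - M₂ + m, r.2) .W := by
        have := hWW (M₂ - m) (by omega)
        rwa [show (r.1 : ℤ) - ((M₂ - m : ℕ) : ℤ) = r.1 - M₂ + m by push_cast [Nat.cast_sub (show m ≤ M₂ by omega)]; ring] at this
      have hcN : ¬ω.2.UsesSide ((r.1 : ℤ) - M₂ + m, r.2) .N := by
        intro hu
        obtain ⟨M', hS', -, hend'⟩ := ω.2.chain_N hY hu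
        simp only at hS' hend'
        rcases hend' with ⟨hM1, hnot⟩ | ⟨-, hs0⟩ | ⟨hZ, -⟩
        · obtain ⟨i', hi', hfc', hsv', -, -, -, hk'⟩ := ω.2.isolated_of_usesSide_not_opp (hS' M' hM1 le_rfl) hnot
          have hP' : P ((r.1 : ℤ) - M₂ + m, r.2 + M') := by rw [← hfc']; exact hPiso i' hi' hsv' hk'
          have hrow' : ((((r.1 : ℤ) - M₂ + m, r.2 + M') : Face)).2 = Y := by
            rcases hProw _ hP' with e | e | e | e <;> simp only at e ⊢ <;> omega
          rcases htop2 _ hP' hrow' with e | e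
          · have := congrArg Prod.fst e; simp only at this; omega
          · rw [htₒ] at e; have := congrArg Prod.fst e; simp only at this; omega
        · exact absurd hs0 h0N
        · rw [hL] at hZ; have := congrArg Prod.fst hZ; simp only at this; omega
      exact ω.2.straight_of_usesSide_EW hcE hcW hcN i hi hfi
    have hM1j : M₂ - 1 ≤ j₁ := by
      by_contra hlt
      push Not at hlt
      obtain ⟨hfc0, -⟩ := ω.2.run_back_east_of_straight hj₁n le_rfl hin₁
        (fun m hm1 hmM i hi hfi => hrowStraight m hm1 (by omega) i hi (by rw [hfi, hfc₁'])) j₁ le_rfl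
      rw [Nat.sub_self, h0w, hfc₁'] at hfc0
      have := congrArg Prod.snd hfc0; simp only at this; omega
    have hrun₁ := ω.2.run_back_east_of_straight hj₁n hM1j hin₁
      (fun m hm1 hmM i hi hfi => hrowStraight m hm1 hmM i hi (by rw [hfi, hfc₁']))
    obtain ⟨hfcr1, hinr1⟩ := hrun₁ (M₂ - 1) le_rfl
    rw [hfc₁'] at hfcr1; simp only at hfcr1
    have hF1 : 1 ≤ j₁ - (M₂ - 1) := by
      by_contra hlt
      have e0 : j₁ - (M₂ - 1) = 0 := by omega
      rw [e0, h0w] at hfcr1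
      have := congrArg Prod.snd hfcr1; simp only at this; omega
    obtain ⟨hfcr, -⟩ := ω.2.fc_pred_eq_of_sIn_E (by omega) hF1 hinr1
    rw [hfcr1] at hfcr; simp only at hfcr
    have hfcr' : ω.2.fc (j₁ - (M₂ - 1) - 1) = r := by
      rw [hfcr]; exact Prod.ext (by simp only; push_cast [Nat.cast_sub (show 1 ≤ M₂ by omega)]; ring) rfl
    have hFeq := hsvr _ (by omega) (hfcr'.trans hfcF.symm)
    -- every excursion arc lies on a row `≥ r.2`; but the excursion meets the root row (the even–odd rule)
    obtain ⟨i, hFi, hin, -, hrow, -⟩ := exists_tail_arc_rootRow_S hr h hA hwr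
    rcases Nat.lt_or_ge j₁ i with h1 | h1
    · rcases Nat.lt_or_ge (n - 1 - dT - M₂) i with h2 | h2
      · rcases Nat.lt_or_ge (n - 1 - dT) i with h3 | h3
        · -- on the final descent
          have e := hdesc (n - 1 - i) (by push_cast [Nat.cast_sub (show i ≤ n - 1 by omega)]; omega)
          rw [show n - 1 - (n - 1 - i) = i by omega] at e
          rw [e] at hrow; simp only at hrow; omega
        · -- on the top row
          obtain ⟨e, -⟩ := hrunT (n - 1 - dT - i) (by omega)
          rw [show n - 1 - dT - (n - 1 - dT - i) = i by omega, hfcT] at e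
          rw [e] at hrow; simp only at hrow; omega
      · -- on the column `r.1 − MW` above the row of `r`
        obtain ⟨e, -⟩ := hrunₒ (n - 1 - dT - M₂ - i) (by omega)
        rw [show n - 1 - dT - M₂ - (n - 1 - dT - M₂ - i) = i by omega, hfcₒ'] at e
        rw [e] at hrow; simp only at hrow; omega
    · -- on the row of `r`
      obtain ⟨e, -⟩ := hrun₁ (j₁ - i) (by omega)
      rw [show j₁ - (j₁ - i) = i by omega, hfc₁'] at e
      rw [e] at hrow; simp only at hrow; omega
  ---------------------------------------------------------------- `e_W` does not use `N`; its `S`-chain is the west leg down to the bottom turn `b_W = (r.1 − MW, Y')`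
  have heWnN : ¬ω.2.UsesSide ((r.1 : ℤ) - MW, r.2) .N := by
    rintro ⟨j, hj, hfj, hsN⟩
    obtain ⟨j', hj', hfj', hsS⟩ := heWS
    have e1 := hsvW _ _ hj hjW hfj hfcW
    have e2 := hsvW _ _ hj' hjW hfj' hfcW
    rw [e1] at hsN; rw [e2] at hsS
    have hne := ω.2.sIn_ne_sOut hjW
    revert hsE hsN hsS hne
    cases ω.2.sIn jW <;> cases ω.2.sOut jW <;> decide
  obtain ⟨M₃, hN3, hS3, hend3⟩ := ω.2.chain_S hY' heWS
  simp only at hN3 hS3 hend3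
  obtain ⟨hM₃, hbW, hbWnS⟩ : (M₃ : ℤ) = r.2 - Y' ∧ (((r.1 : ℤ) - MW, Y') = b₁ ∨ ((r.1 : ℤ) - MW, Y') = b₂) ∧
      ¬ω.2.UsesSide ((r.1 : ℤ) - MW, Y') .S := by
    rcases hend3 with ⟨hM1, hnot⟩ | ⟨hA0, -⟩ | ⟨hZ, -⟩
    · obtain ⟨i', hi', hfc', hsv', -, -, -, hk'⟩ := ω.2.isolated_of_usesSide_not_opp (hN3 M₃ hM1 le_rfl) hnot
      have hP' : P ((r.1 : ℤ) - MW, r.2 - M₃) := by rw [← hfc']; exact hPiso i' hi' hsv' hk'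
      have hrow' : ((((r.1 : ℤ) - MW, r.2 - M₃) : Face)).2 = Y' := by
        rcases hmem7 _ hP' with e | e | e | e | e | e | e
        · exfalso; have := congrArg Prod.snd e; rw [ht₁row] at this; simp only at this; omega
        · exfalso; have := congrArg Prod.snd e; rw [ht₂row] at this; simp only at this; omega
        · have := congrArg Prod.snd e; rw [hb₁row] at this; simpa only using this
        · have := congrArg Prod.snd e; rw [hb₂row] at this; simpa only using this
        · exfalso; have := congrArg Prod.fst e; simp only at this; omega
        · exfalso; have := congrArg Prod.snd e; simp only at this; omega
        · exfalso; have := congrArg Prod.fst e; simp only at this; omega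
      simp only at hrow'
      have eM : (M₃ : ℤ) = r.2 - Y' := by omega
      have ecell : (((r.1 : ℤ) - MW, r.2 - M₃) : Face) = ((r.1 : ℤ) - MW, Y') := Prod.ext rfl (by simp only; omega)
      rw [ecell] at hP' hnot
      exact ⟨eM, hbots _ hP' rfl, hnot⟩
    · rw [h0w] at hA0; have := congrArg Prod.fst hA0; simp only at this; omega
    · rw [hL] at hZ; have := congrArg Prod.fst hZ; simp only at this; omega
  -- name the other bottom turn `bₒ`
  obtain ⟨bₒ, hPbₒ, hbₒrow, hbₒne, hbot2⟩ : ∃ bₒ : Face, P bₒ ∧ bₒ.2 = Y' ∧ bₒ ≠ ((r.1 : ℤ) - MW, Y') ∧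
      ∀ f : Face, P f → f.2 = Y' → f = ((r.1 : ℤ) - MW, Y') ∨ f = bₒ := by
    rcases hbW with hB | hB
    · refine ⟨b₂, hP7 b₂ (Or.inr (Or.inr (Or.inr (Or.inl rfl)))), hb₂row, fun e => hb12 (hB.symm.trans e.symm), fun f hPf hfY => ?_⟩
      rcases hbots f hPf hfY with e | e
      · exact Or.inl (e.trans hB.symm)
      · exact Or.inr e
    · refine ⟨b₁, hP7 b₁ (Or.inr (Or.inr (Or.inl rfl))), hb₁row, fun e => hb12 (e.trans hB), fun f hPf hfY => ?_⟩
      rcases hbots f hPf hfY with e | e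
      · exact Or.inr e
      · exact Or.inl (e.trans hB.symm)
  have hbₒcol : bₒ.1 ≠ r.1 - MW := by
    intro e; apply hbₒne; exact Prod.ext e hbₒrow
  ---------------------------------------------------------------- assemble
  refine ⟨Y, Y', τ1, MW, ME, tₒ, bₒ, hY, hY', hr₃, hY'w, htₒrow, htₒcol, hbₒrow, hbₒcol, hτ1w, hMW1, hME1, hEW, hWW, hnotW, hWE, hEE, hnotE,
    ?_, ?_, hN1, hL, hLS, hdesc, hdescIn, heWS, heWnN, fun m hm1 hmM => hN3 m hm1 (by omega), fun m hmM => hS3 m (by omega), hbWnS⟩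
  · intro f hf
    simp only [Finset.mem_insert, Finset.mem_singleton] at hf
    rcases hf with rfl | rfl | rfl | rfl | rfl | rfl | rfl
    · exact hPT
    · exact hPtₒ
    · rcases hbW with e | e <;> rw [e]
      · exact hP7 b₁ (Or.inr (Or.inr (Or.inl rfl)))
      · exact hP7 b₂ (Or.inr (Or.inr (Or.inr (Or.inl rfl))))
    · exact hPbₒ
    · exact hP7 _ (Or.inr (Or.inr (Or.inr (Or.inr (Or.inl rfl)))))
    · exact hP7 _ (Or.inr (Or.inr (Or.inr (Or.inr (Or.inr (Or.inl rfl))))))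
    · exact hP7 _ (Or.inr (Or.inr (Or.inr (Or.inr (Or.inr (Or.inr rfl))))))
  · intro f hf hk
    have hPf : P f := ⟨hf, hk⟩
    simp only [Finset.mem_insert, Finset.mem_singleton]
    rcases hmem7 f hPf with e | e | e | e | e | e | e
    · rcases htop2 f hPf (by rw [e, ht₁row]) with e' | e'
      · exact Or.inl e'
      · exact Or.inr (Or.inl e')
    · rcases htop2 f hPf (by rw [e, ht₂row]) with e' | e'
      · exact Or.inl e'
      · exact Or.inr (Or.inl e')
    · rcases hbot2 f hPf (by rw [e, hb₁row]) with e' | e'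
      · exact Or.inr (Or.inr (Or.inl e'))
      · exact Or.inr (Or.inr (Or.inr (Or.inl e')))
    · rcases hbot2 f hPf (by rw [e, hb₂row]) with e' | e'
      · exact Or.inr (Or.inr (Or.inl e'))
      · exact Or.inr (Or.inr (Or.inr (Or.inl e')))
    · exact Or.inr (Or.inr (Or.inr (Or.inr (Or.inl e))))
    · exact Or.inr (Or.inr (Or.inr (Or.inr (Or.inr (Or.inl e)))))
    · exact Or.inr (Or.inr (Or.inr (Or.inr (Or.inr (Or.inr e)))))

end ΩG

end Literature.Probability.RandomPlanarGeometry.SAW.YangBaxter
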